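import Summits.Ventures.WeilGRH.DualTrigKernelTail2
import HarnessLib

/-!
# Format D-K v3 (multi-lattice): the kernel checker — data and the complete check `DKCert3.check3`

Cell `rh-explicit`, WEIL TRACK — GRH ARM, route B (weil-grh-3).  A format-D-K certificate (`DKCert`,
`DualTrigKernelDefs/Check.lean`) puts every atom `a cos(κτ) + b sin(κτ)` on ONE frequency lattice
`κ ∈ ω ℕ`, `ω = log p₀ / D`; the window terms `−2Λ(n)/√n · Re(χ(n) e^{−iτ log n})` with `n` not a power
of `p₀` are then incommensurable with everything else, and in the tail inequality (`tailOK`, `tailOK2`)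
they can only be bounded by their amplitudes: `B_inc = Σ α_n` (`= 4.18` at `N = 7`).  By Kronecker's
theorem this bound is TIGHT for the far tail, so a single-lattice certificate must cover `|τ| ≤ L` with
`Re ψ(σ' + iL/2) ≥ B_inc − (log q − log π) − mT`, i.e. `L ≈ 110–320` for conductors `17–29`.

A v3 certificate `DKCert3` = a base certificate (lattice `p₀`, usually `2`) + extra lattices
`(p, D_p)` carrying their own atoms with frequencies `k ω_p`, `ω_p = log p / D_p` (`k ω_p ≥ log(N+1)`,
i.e. `p^k ≥ (N+1)^{D_p}`, decided in `ℕ`).  The window terms `n = p^e` join the lattice of `p`: the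
part `T_p = (window terms of p) + (atoms of lattice p)` is `2π/ω_p`-periodic in `τ`, its minimum over a
period `mT_p` is certified on the cells meeting `|θ| ≤ π/r_p` (`θ = ωτ`, `r_p = ω_p/ω`, "lattice
duty"), and the tail inequality becomes

  `Re ψ(σ' + iỹ) + (log q − log π) + mT + Σ_p mT_p − B_rest ≥ 0`,

`B_rest` = amplitudes of the window terms on NO lattice (empty when the lattices are all primes `≤ N`).
In the cells the extra atoms are ordinary non-integer-frequency terms of the existing cell machinery
(`DKCert.cellLo` with the term list `terms3`; enclosure `rC ∋ r_p` claimed, checked against the engine),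
so the whole per-cell soundness (`DKCert.cellLo_sound`) is reused verbatim; the only new per-cell
object is `DKCert.cellLoT` (the trigonometric lower bound of a term list WITHOUT the digamma data) for
the lattice-duty bounds.  Everything here is a DEFINITION (total, kernel-evaluable); the soundness and
the family theorem `DKCert3.weilPositivityOnChar_family_of_check3` are in `DualTrigKernelLattice*.lean`.

## References

* R. E. Moore, *Interval Analysis* (1966), Ch. 3–4 (interval extensions; the engine). [folklore]
* L. Kronecker (1884), simultaneous approximation — why the single-lattice tail bound is tight. [folklore]
-/

namespace Summit.Ventures.WeilGRH

open Literature.Analysis.ValidatedNumerics.NumericsMP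

/-- An extra frequency lattice of a format-D-K v3 certificate: atoms `(a/2^cden) cos(k ω_p τ) +
(b/2^cden) sin(k ω_p τ)`, `ω_p = log p / D`, the claimed (scaled) lower bound `mT` of its periodic part
`T_p` over one period, and a CLAIMED enclosure `rC` of the ratio `r_p = ω_p / ω = D₀ log p / (D log p₀)`
(checked once against the engine). [folklore] -/
structure DKLat where
  /-- the base of the lattice (`≥ 2`; a prime `≤ N` in practice) -/
  p : ℕ
  /-- divisor `D ≥ 1`: `ω_p = log p / D` -/
  D : ℕ
  /-- the atoms (integer multiples `k` of `ω_p`) -/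
  atoms : List DKAtom
  /-- claimed lower bound (scaled by `S`) of `T_p` over one period -/
  mT : ℤ
  /-- claimed enclosure (scaled endpoints) of `r_p = D₀ log p / (D log p₀)` -/
  rC : ℤ × ℤ
  deriving DecidableEq, Repr

/-- A format-D-K v3 (multi-lattice) certificate: a base format-D-K certificate (its `atoms` live on the
base lattice `ω = log p₀ / D₀`, its `mT` bounds the base periodic part) and extra lattices. [folklore] -/
structure DKCert3 where
  /-- the base certificate: engine parameters, modulus, parity, window, base lattice, cells, constants -/
  base : DKCert
  /-- the extra lattices -/
  lats : List DKLat
  deriving Repr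

namespace DKCert

variable (c : DKCert)

/-- The trigonometric lower bound (scaled) of a term list on cell `j` of block `b`: interval Horner on the
Taylor coefficients of ALL the terms, minus the block remainder `E`; no digamma data (compare `cellLo`,
whose second component does the same for the periodic sub-list). [folklore] -/
def cellLoT (b : DKBlock) (ts : List GTerm) (E : MI) (j : ℤ) : Option ℤ :=
  match c.moments b j ts with
  | some acc => some (c.innerLo b (c.coeffs acc.1) - E.hi)
  | none => none

/-- Is the window value an incommensurable (non-periodic) term of the base lattice?  The same criterion
as the `comm` flag of `valTerm`: `n` is not a power of `p₀`. [folklore] -/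
def ncVal (v : DKVal) : Bool := (logExact c.p0 v.n).isNone

end DKCert

namespace DKCert3

variable (c : DKCert3)

/-! ### Terms -/

/-- The claimed ratio `r_p = ω_p/ω` of a lattice as an interval. [folklore] -/
def _root_.Summit.Ventures.WeilGRH.DKLat.rI (l : DKLat) : MI := DKCert.ofPair l.rC

/-- The computed term (in the base variable `θ = ωτ`) of an atom of lattice `l`: frequency `κ = k r_p`
(an interval; non-integer path of the cell machinery), coefficients `a/2^cden`, `b/2^cden`. [folklore] -/
def latAtomTerm (l : DKLat) (atm : DKAtom) : DKCert.GTerm :=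
  let kI := l.rI.mulInt atm.k
  { k := 0, isInt := false, rI := kI,
    A := MI.ofFrac c.base.S atm.a (2 ^ c.base.cden), B := MI.ofFrac c.base.S atm.b (2 ^ c.base.cden),
    kpow := DKCert.powList c.base.S kI (2 * c.base.R + 1), kpowZ := [], comm := false }

/-- The atom terms of one lattice. [folklore] -/
def latAtomTerms (l : DKLat) : List DKCert.GTerm := l.atoms.map (c.latAtomTerm l)

/-- The atom terms of a list of lattices, concatenated in order. [folklore] -/
def latJoin : List DKLat → List DKCert.GTerm
  | [] => []
  | l :: ls => c.latAtomTerms l ++ latJoin ls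

/-- All terms of the full inequality: the base terms (base atoms, window) followed by all lattice atoms.
[folklore] -/
def terms3 : List DKCert.GTerm := c.base.terms ++ c.latJoin c.lats

/-- The incommensurable window values. [folklore] -/
def ncVals : List DKVal := c.base.vals.filter c.base.ncVal

/-- The window values on lattice `l` (prime powers of `l.p` that are not powers of `p₀`). [folklore] -/
def latVals (l : DKLat) : List DKVal := c.ncVals.filter fun v => v.p == l.p

/-- The incommensurable window values on no lattice. [folklore] -/
def restVals : List DKVal := c.ncVals.filter fun v => !((c.lats.map (·.p)).elem v.p)

/-- The computed window terms of lattice `l` (or `none`). [folklore] -/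
def latWinTerms (l : DKLat) : Option (List DKCert.GTerm) := ((c.latVals l).map c.base.valTerm).mapM id

/-- The terms of the periodic part `T_p` of lattice `l`: its window terms, then its atoms. [folklore] -/
def latTerms (l : DKLat) : List DKCert.GTerm := (c.latWinTerms l).getD [] ++ c.latAtomTerms l

/-- The computed window terms on no lattice (or `none`). [folklore] -/
def restTerms : Option (List DKCert.GTerm) := (c.restVals.map c.base.valTerm).mapM id

/-- `Σ termAmp` (scaled) over the window terms on no lattice: the only amplitude loss of the v3 tail.
[folklore] -/
def bInc3 : ℤ := ((c.restTerms.getD []).map DKCert.termAmp).sum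

/-! ### Cells -/

/-- Does cell `j` of block `b` carry duty for lattice `l`: can it meet `|θ| ≤ π/r_p`?  Tested with the
LOWER claimed endpoint of `r_p` (a larger zone is safe). [folklore] -/
def latDuty (l : DKLat) (b : DKBlock) (j : ℤ) : Bool :=
  decide (2 * j * l.rI.lo ≤ (b.Mc : ℤ) * c.base.S) && decide (-((b.Mc : ℤ) * c.base.S) ≤ (2 * j + 2) * l.rI.lo)

/-- The lattice-duty check of one lattice on one cell: off duty, or `mT_p ≤` the trigonometric lower bound
of `T_p` on the cell. [folklore] -/
def latCellOK (b : DKBlock) (l : DKLat) (ts : List DKCert.GTerm) (E : MI) (j : ℤ) : Bool :=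
  !c.latDuty l b j ||
    match c.base.cellLoT b ts E j with
    | some lov => decide (l.mT ≤ lov)
    | none => false

/-- All lattice-duty checks on one cell (term lists and remainders precomputed per block, in lattice
order). [folklore] -/
def latCellsOK (b : DKBlock) : List DKLat → List (List DKCert.GTerm × MI) → ℤ → Bool
  | [], _, _ => true
  | _ :: _, [], _ => false
  | l :: ls, (ts, E) :: rest, j => c.latCellOK b l ts E j && latCellsOK b ls rest j

/-- The per-block data of the lattices: `(latTerms l, remBlock)`. [folklore] -/
def latData (b : DKBlock) : List (List DKCert.GTerm × MI) :=
  c.lats.map fun l => (c.latTerms l, c.base.remBlock (c.base.etaPow b) (c.latTerms l))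

/-- Check the cells `j0 + i`, `i0 ≤ i < i0 + cnt`, of a block: the full inequality with ALL terms (and the
base period duty) through `DKCert.cellOK`, and the lattice duties. [folklore] -/
def blockRangeOK3 (b : DKBlock) (i0 cnt : ℕ) : Bool :=
  let ts := c.terms3
  let E := c.base.remBlock (c.base.etaPow b) ts
  let ld := c.latData b
  (List.range cnt).all fun i =>
    c.base.cellOK b ts E (b.j0 + (i0 + i : ℕ)) && c.latCellsOK b c.lats ld (b.j0 + (i0 + i : ℕ))

/-- All cells of all blocks. [folklore] -/
def cells3OK : Bool := c.base.blocks.all fun b => c.blockRangeOK3 b 0 b.n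

/-! ### Frame: lattices, coverage, tail -/

/-- Checks on the lattices: `p ≥ 2`, `p ≠ p₀`, `D ≥ 1`, distinct `p`; the claimed ratio encloses the engine's
`D₀ log p / (D log p₀)` and has a positive lower end; every atom is admissible for the rung
(`(N+1)^D ≤ p^k` in `ℕ`); in the even case all sine coefficients vanish; the window terms of the lattice
and of the rest were computed. [folklore] -/
def latsOK : Bool :=
  decide ((c.lats.map (·.p)).Nodup) && c.restTerms.isSome &&
  c.lats.all fun l =>
    decide (2 ≤ l.p) && decide (l.p ≠ c.base.p0) && decide (1 ≤ l.D) && decide (0 < l.rI.lo) &&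
    (match MI.logNat c.base.S c.base.Kser l.p with
      | some Lp =>
        match MI.divPos c.base.S (Lp.mulInt c.base.D) (c.base.logp0I.mulInt l.D) with
        | some R => DKCert.encl l.rI R
        | none => false
      | none => false) &&
    (l.atoms.all fun atm => decide ((c.base.N + 1) ^ l.D ≤ l.p ^ atm.k)) &&
    (!c.base.even || l.atoms.all fun atm => atm.b == 0) &&
    (c.latWinTerms l).isSome

/-- The covered range contains one period zone `|θ| ≤ π/r_p` of every lattice (`θ ≥ 0` half in the even
case), tested with the lower claimed endpoint of `r_p`. [folklore] -/
def latCoverOK : Bool :=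
  match c.base.blocks.head?, c.base.blocks.getLast? with
  | some b0, some bl =>
    c.lats.all fun l =>
      decide ((bl.Mc : ℤ) * c.base.S ≤ 2 * (bl.j0 + bl.n) * l.rI.lo) &&
      (c.base.even || decide (2 * b0.j0 * l.rI.lo ≤ -((b0.Mc : ℤ) * c.base.S)))
  | _, _ => false

/-- `Σ_p mT_p` over the lattices. [folklore] -/
def mTsum : ℤ := (c.lats.map (·.mT)).sum

/-- **The v3 tail check**: at both ends of the covered range,
`Re ψ(σ'+iỹ) + (log q − log π) − B_rest + mT + Σ_p mT_p ≥ 0`. [folklore] -/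
def tailOK3 : Bool :=
  match c.base.blocks.head?, c.base.blocks.getLast? with
  | some b0, some bl =>
    let ok (Mc : ℕ) (jj : ℤ) : Bool :=
      match c.base.psiTailLo Mc jj with
      | some v => decide (0 ≤ v + c.base.constI.lo - c.bInc3 + c.base.mT + c.mTsum)
      | none => false
    ok bl.Mc (bl.j0 + bl.n) && (c.base.even || ok b0.Mc b0.j0)
  | _, _ => false

/-- The base frame without its tail: constants, window data, distinct window values, block shapes and
tables, base atoms admissible. [folklore] -/
def baseFrameOK : Bool :=
  c.base.constsOK && c.base.valsOK && c.base.valsNodup && c.base.blocksOK && c.base.atomsOK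

/-- **The v3 frame**: base frame, lattices, coverage, tail. [folklore] -/
def frame3OK : Bool := c.baseFrameOK && c.latsOK && c.latCoverOK && c.tailOK3

/-- **The complete v3 check.** [folklore] -/
def check3 : Bool := c.frame3OK && c.cells3OK


/-! ### The fast phase source and the cell checks built on it

The generic `DKCert.phase` obtains the centre phase of a non-integer-frequency term from `MC.expI` with
the certificate's `Kser`-term series (sized for the logarithms); with many lattice atoms per cell this
dominates the kernel time.  `phase3` uses the short series `K2 = 12` after `k2 = 5` halvings (argument
`≤ π/32` after the reduction modulo `2π`; `(π/32)^12/12! < 10⁻²⁰`), and `moments3` / `cellLo3` / `cellLoT3`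
are `DKCert.moments` / `DKCert.cellLo` / `DKCert.cellLoT` with this phase source; `blockRangeOKL`,
`cellsOKL`, `checkL` are the cell and complete checks built on them (they supersede `blockRangeOK3`,
`cells3OK`, `check3` above, which stay as first filed).  Soundness: `DualTrigKernelLatticeCells.lean`
(`MC.mem_expI` holds for every series length). -/

/-- Series length of the cheap `expI` used for the centre phases of non-integer-frequency terms. [folklore] -/
def K2 : ℕ := 12

/-- Halvings of the cheap `expI` (see `K2`). [folklore] -/
def k2 : ℕ := 5

/-- The centre phase `(cos κθ_c, sin κθ_c)`, `θ_c = (2j+1)π/Mc`, of a term on cell `j` of block `b`: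
integer frequencies from the block table (as `DKCert.phase`), interval frequencies by the cheap `expI`.
[folklore] -/
def phase3 (b : DKBlock) (j : ℤ) (t : DKCert.GTerm) : Option MC :=
  if t.isInt then c.base.phase b j t
  else MC.expI c.base.S K2 k2 c.base.piI (MI.mul c.base.S t.rI ((c.base.piI.mulInt (2 * j + 1)).divNat b.Mc))

/-- `DKCert.moments` with the phase source `phase3`. [folklore] -/
def moments3 (b : DKBlock) (j : ℤ) : List DKCert.GTerm → Option (List MI × List MI)
  | [] => some (c.base.zeroMom, c.base.zeroMom)
  | t :: ts =>
    match moments3 b j ts with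
    | none => none
    | some (accA, accN) =>
      match c.phase3 b j t with
      | none => none
      | some Z =>
        let UV := c.base.rotUV t Z
        some (c.base.addTerm t UV.1 UV.2 accA, if t.comm then accN else c.base.addTerm t UV.1 UV.2 accN)

/-- `DKCert.cellLo` with the phase source `phase3`: the two lower bounds (full inequality, base periodic
part) of cell `j`, scaled by `S`. [folklore] -/
def cellLo3 (b : DKBlock) (ts : List DKCert.GTerm) (E : MI) (j : ℤ) : Option (ℤ × ℤ) :=
  match c.moments3 b j ts, c.base.digammaData b j with
  | some acc, some (BR, F0, F1, EF) =>
    let cs := c.base.coeffs acc.1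
    let cs' := match cs with
      | c0 :: c1 :: rest => (((c0.add BR).add F0).add c.base.constI) :: (c1.add F1) :: rest
      | other => other
    some (c.base.innerLo b cs' - E.hi - EF.hi, c.base.innerLo b (c.base.coeffs (c.base.periodicMom acc)) - E.hi)
  | _, _ => none

/-- The trigonometric lower bound (scaled) of a term list on cell `j` (no digamma data), phases from
`phase3`. [folklore] -/
def cellLoT3 (b : DKBlock) (ts : List DKCert.GTerm) (E : MI) (j : ℤ) : Option ℤ :=
  match c.moments3 b j ts with
  | some acc => some (c.base.innerLo b (c.base.coeffs acc.1) - E.hi)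
  | none => none

/-- The full check of one cell: full lower bound `≥ 0` and, on base period duty, the base periodic bound
`≥ mT`. [folklore] -/
def cellOK3 (b : DKBlock) (ts : List DKCert.GTerm) (E : MI) (j : ℤ) : Bool :=
  match c.cellLo3 b ts E j with
  | some (lov, loT) => decide (0 ≤ lov) && (!DKCert.periodDuty b j || decide (c.base.mT ≤ loT))
  | none => false

/-- The lattice-duty check of one lattice on one cell (fast phases): off duty, or `mT_p ≤` the trigonometric
lower bound of `T_p` on the cell. [folklore] -/
def latCellOKL (b : DKBlock) (l : DKLat) (ts : List DKCert.GTerm) (E : MI) (j : ℤ) : Bool :=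
  !c.latDuty l b j ||
    match c.cellLoT3 b ts E j with
    | some lov => decide (l.mT ≤ lov)
    | none => false

/-- All lattice-duty checks on one cell (fast phases). [folklore] -/
def latCellsOKL (b : DKBlock) : List DKLat → List (List DKCert.GTerm × MI) → ℤ → Bool
  | [], _, _ => true
  | _ :: _, [], _ => false
  | l :: ls, (ts, E) :: rest, j => c.latCellOKL b l ts E j && latCellsOKL b ls rest j

/-- Check the cells `j0 + i`, `i0 ≤ i < i0 + cnt`, of a block (fast phases): the full inequality with ALL
terms (and the base period duty), then the lattice duties. [folklore] -/
def blockRangeOKL (b : DKBlock) (i0 cnt : ℕ) : Bool :=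
  let ts := c.terms3
  let E := c.base.remBlock (c.base.etaPow b) ts
  let ld := c.latData b
  (List.range cnt).all fun i =>
    c.cellOK3 b ts E (b.j0 + (i0 + i : ℕ)) && c.latCellsOKL b c.lats ld (b.j0 + (i0 + i : ℕ))

/-- All cells of all blocks (fast phases). [folklore] -/
def cellsOKL : Bool := c.base.blocks.all fun b => c.blockRangeOKL b 0 b.n

/-- **The complete v3 check** (fast phases): frame and cells. [folklore] -/
def checkL : Bool := c.frame3OK && c.cellsOKL

end DKCert3

end Summit.Ventures.WeilGRH
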